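import Summits.BirchSwinnertonDyer.BirchSwinnertonDyer.Theses.PrintX8VSC
import Summits.BirchSwinnertonDyer.BirchSwinnertonDyer.Theorems.SignedLowerHalvesSprungLowerDivisibilityAtThreeKeyingDoor
import HarnessLib

/-!
# Route `PrintX8VSC`, item stmt-BirchSwinnertonDyer-23742 `SharpFlatMainConjectureX8Contra` through the KEYING DOOR:
# the print-keyed main-conjecture node EQUALS its `ι`-twisted tree-keyed reading (one `↔`, by name; no new
# mathematics, nothing closed)

Cell `bsd-print-x8`, width seat `bsd-print-x8-w4` (director-bsd (309)(8): «23742 print-keyed port by the ι-twist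
dictionary (N-287b rule)»). HONEST FRAMING: bookkeeping only — this is the x8 keying door of
`Theorems/SignedLowerHalvesSprungLowerDivisibilityAtThreeKeyingDoor.lean` (ns `ChromaticKeying`, bsd-ssimc width w3 g8,
p661746: `forall_torsion_generatorEqShape_iff_forall_contra`, built on the Literature dictionary
`Sprung2012.sharpFlatSelmerDualData_charIdeal_inv_eq` — `char(D′.X) = ι(char(D.X))` for ANY `D` of key `γ`, `D′` of
key `γ⁻¹`) instantiated on the ROUTE-OF-RECORD's node 23742, binder for binder. That file states the door for the
`γ`-keyed leaf defs `Theorems.SprungSharpFlatMainConjecture` / `SprungSharpFlatLowerDivisibility` (the dormant route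
`PrintX8VS`'s nodes); the served route `PrintX8VSC` inlines Main Conj. 7.21 AS PRINTED (key `γ⁻¹`) as
`SharpFlatMainConjectureX8Contra`, and referee rule N-287b (x8 REF-AUDIT R-287) requires every transfer between the two
keys to pass through exactly this dictionary. The theorem below is that rule for the node itself:

`SharpFlatMainConjectureX8Contra` (for every print-keyed `D′ = X^•(γ⁻¹)` on an X8 pair of analytic rank `≤ 1`: `D′.X`
torsion, `char(D′.X) = (G)`, `G ≐ ϖ·L^•` rationally) `↔` the SAME text over every TREE-keyed `D = X^•(γ) = (𝒳^•*)^ι`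
with the generator `≐ ϖ·ι(L^•)` — i.e. a `γ`-keyed main-conjecture statement serves MC′ iff it carries `ι(L^•)`, not
`L^•`, on the analytic side (for Sprung's `L♯/L♭` at `a₃ ≠ 0`, `ι` is not a unit change: it moves private zeros
between the colours, `ChromaticIota.ClassX8.mem_and_mem_iff_sharp_iotaPair`; hence the keying flags B-282/B-283 on
the dormant route's `γ`-keyed node `SharpFlatMainConjectureX8`, item 20304, whose generator is `≐ ϖ·L^•`).
MC′, K′, C′, the leaf X8 and BSD are NOT proved; nothing is asserted about either side's truth beyond `↔`.

References: [Sprung2012] Def. 7.11 (p. 1503), §7.5 l.1, Main Conj. 7.21 (p. 1505); [Greenberg1989] §0 pp. 101–102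
(`S^ι`); [GreenbergLNM1716] §1 (p. 60); [MazurTateTeitelbaum1986Invent] Ch. I §17; route file `Theses/PrintX8VSC.lean`
rev 4 (item 23742); x8 REF-AUDIT R-281 (keying door), R-287 N-287b.
-/

set_option autoImplicit false
-- justification: the mandated namespace `Summit.BirchSwinnertonDyer.BirchSwinnertonDyer.Theorems`
-- (single-conjunct summit, Sub = Summit) repeats a segment by design (D-0017).
set_option linter.dupNamespace false

noncomputable section

open scoped Classical

namespace Summit.BirchSwinnertonDyer.BirchSwinnertonDyer.Theorems.PrintX8VSCInvolDictionary

open Literature.NumberTheory.EllipticCurves Literature.NumberTheory.EllipticCurves.IwasawaAlgebra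
  Literature.NumberTheory.EllipticCurves.Rank1Residual Literature.NumberTheory.EllipticCurves.Sprung2017
  Literature.NumberTheory.EllipticCurves.Sprung2012 Literature.NumberTheory.EllipticCurves.ModularForms
  Summit.BirchSwinnertonDyer.BirchSwinnertonDyer.Theorems.ChromaticKeying
  Summit.BirchSwinnertonDyer.BirchSwinnertonDyer.Theses.PrintX8VSC

/-- **Item stmt-BirchSwinnertonDyer-23742 `SharpFlatMainConjectureX8Contra` `↔` its `ι`-twisted tree-keyed reading**
(the keying door `ChromaticKeying.forall_torsion_generatorEqShape_iff_forall_contra` at `L := ι(L^•)`, under the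
node's 30 outer binders). Left: Sprung's Main Conj. 7.21 AS PRINTED on the X8 leaf at analytic rank `≤ 1` — every
print-keyed ♯/♭ dual `D′ = X^•(γ⁻¹)` is `Λ`-torsion with `char(D′.X) = (G)`, `G ≐ ϖ·L^•`. Right: every TREE-keyed
`D = X^•(γ)` is `Λ`-torsion with `char(D.X) = (g)`, `g ≐ ϖ·ι(L^•)`. No fact used; nothing about either side's truth.
[cite: Sprung2012, Def. 7.11 (p. 1503), Main Conj. 7.21 (p. 1505)] [cite: GreenbergLNM1716, §1 (p. 60)]
[cite: MazurTateTeitelbaum1986Invent, Ch. I §17] -/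
theorem sharpFlatMainConjectureX8Contra_iff_invol :
    SharpFlatMainConjectureX8Contra ↔
      ∀ (W : WeierstrassCurve ℚ) [W.IsElliptic] [W.IsGloballyMinimal] (p : ℕ) [Fact p.Prime],
        ClassX8 W p → W.analyticRank ≤ 1 →
      ∀ (col : Chroma) (κ : ZpExtension ℚ p) (γ : Field.absoluteGaloisGroup ℚ),
        κ.IsCyclotomic → κ.IsTopGenerator γ → IsCyclotomicVariable p γ →
      ∀ (v : IsDedekindDomain.HeightOneSpectrum (NumberField.RingOfIntegers ℚ)),
        (p : NumberField.RingOfIntegers ℚ) ∈ v.asIdeal →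
      ∀ (g : Field.absoluteGaloisGroup (v.adicCompletion ℚ)),
        κ.IsTopGenerator (resGalOfEmb (closureEmb (K := ℚ) (v.adicCompletion ℚ)) g) →
      ∀ (cneg : localPoints W (v.adicCompletion ℚ)) (c : ℕ → localPoints W (v.adicCompletion ℚ)),
        IsHondaSystem κ (closureEmb (K := ℚ) (v.adicCompletion ℚ)) W (W.frobeniusTrace p) g cneg c →
      ∀ (N : ℕ) (_ : NeZero N) (f : CuspForm (CongruenceSubgroup.Gamma0 N) 2) (ϖ : ℚ)
        (Lsharp Lflat : IwasawaAlgebra p),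
        IsNewformOf W f → (ϖ : ℝ) * W.realPeriodRat = plusPeriod f →
        IsSprungPair f p (W.frobeniusTrace p) Lsharp Lflat → chromaticL col Lsharp Lflat ≠ 0 →
      ∀ (D : SharpFlatSelmerDualData W κ γ (closureEmb (K := ℚ) (v.adicCompletion ℚ))
        (W.frobeniusTrace p) g c col),
        Module.IsTorsion (IwasawaAlgebra p) D.X ∧
          ∃ gen : IwasawaAlgebra p, D.charIdeal = Ideal.span {gen} ∧
            iwasawaToPowerSeries p gen =
              PowerSeries.C (ϖ : ℚ_[p]) * iwasawaToPowerSeries p (invol p (chromaticL col Lsharp Lflat)) := by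
  unfold SharpFlatMainConjectureX8Contra
  iterate 30 refine forall_congr' fun _ ↦ ?_
  rw [forall_torsion_generatorEqShape_iff_forall_contra (ϖ := _) (L := invol _ (chromaticL _ _ _)), invol_invol]

end Summit.BirchSwinnertonDyer.BirchSwinnertonDyer.Theorems.PrintX8VSCInvolDictionary

end
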